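import Summits.QuantumFields.GaugeBoot.FrameThetaWitness
import Summits.QuantumFields.GaugeBoot.WilsonWeightNegativeBeta
import HarnessLib

/-!
# Link reflection positivity FAILS at every `β < 0` for three-dimensional representations of determinant one (gauge-boot, L3 negative supplement; SU(3) link reflection at `β < 0`, part 6)

HONEST FRAMING (cell `pub-gaugeboot`, page 1 of every file): the venture produces certified bounds
on lattice expectations at stated coupling, gauge group, dimension and torus size; NOT a mass gap,
NOT a continuum limit, NOT a string tension; NOT Yang–Mills-summit-bearing (barriers
`FixedCouplingUltralocality`, `PerturbativeInvisibility`). This module is a NEGATIVE structural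
result about which reflection-positivity blocks a lattice bootstrap may use at negative coupling;
it bounds no expectation.

The link (mid-plane) family of Osterwalder–Seiler blocks (`IsSiteFrame.linkRP_integral_conj_mul_nonneg`,
`cubicTorus_linkRP`) carries the hypothesis `0 ≤ β`; for gauge groups with a central involution
represented by `-1` (`SU(2)`, `SU(2n)`, `U(N)`) the staggered central twist removes it
(`CubicTorusLinkRPAnyBeta.lean`); for `SU(3)` nothing was known at `β < 0`. HERE: for a periodic
lattice `(A, e)` with a site frame along `k` (`IsSiteFrame e k σ Q h`, `Q ≥ 2`), directions
`l, m ≠ k` whose theta graph at a site `x₁` of height `1` has seven distinct links (`d ≥ 3`), a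
compact second countable `G` and a continuous THREE-dimensional `ρ` with `det ρ ≡ 1`, scalar
commutant and `ρ ≢ 1` (e.g. `SU(3)`, `SO(3)` in the defining representation):

* **`IsSiteFrame.linkRP_integral_conj_mul_neg_of_neg`** — for EVERY `β < 0` the bounded continuous
  half observable `F = Θ_{x₁} · exp(-β A)` (`thetaWitness`; `Θ_{x₁}` the baryonic theta observable
  of `BaryonThetaObservable.lean`, `A` the positive part of the plaquette sum) has
  `∫ conj F(ΘU) · F(U) dμ_β(U) < 0` (`Θ = configMidReflect e k σ`, `μ_β = gibbs ρ e β`);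
* **`IsSiteFrame.not_linkRP_of_neg`** — closed-half link reflection positivity in the shape of
  `IsSiteFrame.linkRP_integral_conj_mul_nonneg` is FALSE at every `β < 0`.

Proof (exact, no expansion): `e^{-βS} conj F(ΘU) F(U) = e^{-3β#P} conj Θ_{x₁-e_k}(U) Θ_{x₁}(U) ·
(lower slab) · (upper slab)` (witness and geometry: `FrameThetaWitness.lean`); the upper slab is an
independent positive factor (`Q ≥ 2`, `FrameLowerSlab.lean`); integrating the layer `1` against the lower slab transfers `Θ_{x₁}` to the
layer `0` with the factor `z^{|S|-7} c_β⁷` (`Baryon.theta_slab_integral_frozen`), the crossing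
links acting by a gauge transformation under which `Θ` is invariant (`det ρ = 1`); what is left is
`∫ |Θ_{x₁-e_k}|² dμ₀ > 0`, and `c_β < 0` (`WilsonWeightNegativeBeta.lean`): seven is odd
(transfer-matrix reading: the theta spin network joining ADJACENT sites of a bipartite slice is an
eigenfunction with eigenvalue `∝ c_β⁷`, while every Wilson loop has even length). The cubic torus /
`SU(3)` instance is `CubicTorusLinkRPNegativeBeta.lean`.

References: K. Osterwalder, E. Seiler, Ann. Phys. 110 (1978) 440, §2; E. Seiler, LNP 159 (1982)
Ch. 2; M. Creutz, Quarks, Gluons and Lattices (1983) Ch. 8; I. Montvay, G. Münster, Quantum Fields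
on a Lattice (1994) §4.2 (p. 182: the fermionic analogue `K < 0 ⇒ Θ ↦ -Θ`).
-/

noncomputable section

open MeasureTheory Complex
open scoped Matrix ComplexConjugate ComplexOrder
open Literature.MathematicalPhysics.QuantumFieldTheory (haarProbability)
open Literature.MathematicalPhysics.QuantumFieldTheory.LatticeRP (integral_mul_eq_of_dependsOn
  integral_comp_eq_of_measurePreserving)
open Literature.RepresentationTheory.CompactGroups

namespace Summit.QuantumFields.GaugeBoot

namespace TiltedRP

open Baryon TwistedSlab

namespace IsSiteFrame

variable {A : Type*} [AddCommGroup A] [Fintype A] {d : ℕ}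
variable {e : Fin d → A} {k : Fin d} {σ : A →+ A} {Q : ℕ} {h : A →+ ZMod (2 * Q)}
variable (hF : IsSiteFrame e k σ Q h)
include hF
variable {G : Type*} [Group G] (ρ : G →* Matrix (Fin 3) (Fin 3) ℂ)

/-! ## The main computation -/

variable [TopologicalSpace G] [IsTopologicalGroup G] [CompactSpace G]

open scoped Classical in
/-- **The Boltzmann weight against the witness**: pointwise,
`e^{-βS(U)} · e^{-βA(ΘU)} · e^{-βA(U)} = e^{-βN#P} · (lower slab weights on the block) · (upper slab)`.
[folklore] -/
theorem boltzmann_mul_witnessWeights (hρ : Continuous ρ) (β : ℝ) (U : Config A d G) :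
    Real.exp (-β * wilsonAction ρ e U) *
        (Real.exp (-(β * posAction ρ e k Q h (configMidReflect e k σ U))) *
          Real.exp (-(β * posAction ρ e k Q h U))) =
      Real.exp (-(β * (3 * Fintype.card (Plaq A d)))) *
        ((∏ t ∈ lowerBlock k Q h,
            TwistedSlab.wilsonWeight ρ β (lowerA e k Q h t U * (U t)⁻¹ * lowerB e k Q h t U)) *
          ∏ p ∈ Finset.univ.filter (IsUpperPlaq k Q h), Real.exp (β * plaqObs ρ e p U)) := by
  rw [← hF.prod_exp_lower_eq ρ hρ β U, ← Real.exp_add, ← Real.exp_add, wilsonAction_eq,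
    hF.sum_plaqObs_split_mid ρ hρ U, hF.sum_cross_eq_sum_lower_add_sum_upper]
  have h1 : ∀ s : Finset (Plaq A d), ∏ p ∈ s, Real.exp (β * plaqObs ρ e p U) =
      Real.exp (β * ∑ p ∈ s, plaqObs ρ e p U) := fun s => by
    rw [Finset.mul_sum, Real.exp_sum]
  rw [h1, h1, ← Real.exp_add, ← Real.exp_add]
  congr 1
  unfold posAction
  push_cast
  ring

variable [MeasurableSpace G] [BorelSpace G] [SecondCountableTopology G] [DecidableEq A]

/-- **LINK REFLECTION POSITIVITY FAILS AT EVERY `β < 0` (three-dimensional representations of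
determinant one).** Periodic lattice `(A, e)` with a site frame `IsSiteFrame e k σ Q h`; a site `x₁`
of height `1` and directions `l, m ≠ k` whose theta graph has seven distinct links; `G` compact
second countable, `ρ : G → M₃(ℂ)` continuous with `det ρ(g) = 1`, scalar commutant and `ρ ≢ 1`.
Then for every `β < 0` the witness `F = thetaWitness` (bounded, continuous, an observable of the
closed half `{1 ≤ h ≤ Q}`) has `∫ conj F(ΘU) · F(U) dμ_β(U) < 0`, `Θ = configMidReflect e k σ`,
`μ_β = gibbs ρ e β`; the value is `(e^{-3β#P}/Z) (∫ upper slab) z^{|S|-7} c_β⁷ ∫ |Θ_{x₁-e_k}|² < 0`. -/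
theorem linkRP_integral_conj_mul_neg_of_neg (hρ : Continuous ρ) (hirr : TwistedSlab.HasScalarCommutant ρ)
    (hρ1 : ∃ g, ρ g ≠ 1) (hdet : ∀ g, (ρ g).det = 1) {x₁ : A} (hx₁ : (h x₁).val = 1) {l m : Fin d}
    (hl : l ≠ k) (hm : m ≠ k) (hinj : Function.Injective (thetaLink e x₁ l m)) {β : ℝ} (hβ : β < 0) :
    ∫ U, conj (thetaWitness e k Q h ρ β x₁ l m (configMidReflect e k σ U)) *
        thetaWitness e k Q h ρ β x₁ l m U ∂(gibbs ρ e β) < 0 := by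
  classical
  haveI := TwistedSlab.isProbabilityMeasure_productHaar' (A := A) (d := d) (G := G)
  have hQ := hF.two_le
  have hx₀0 : (h (x₁ - e k)).val = 0 := hF.val_height_sub_self_of_one hx₁
  -- the constants
  obtain ⟨c, hcneg, hc⟩ := TwistedSlab.wAvg_wilsonWeight_eq_smul_neg ρ hirr hρ hρ1 hβ (by norm_num)
  have hwc := TwistedSlab.continuous_wilsonWeight ρ hρ β
  have hwinv := TwistedSlab.wilsonWeight_inv ρ hρ β
  have hzr : ∫ g, (TwistedSlab.wilsonWeight ρ β g : ℂ) ∂(haarProbability G) =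
      ((∫ g, TwistedSlab.wilsonWeight ρ β g ∂(haarProbability G) : ℝ) : ℂ) := integral_complex_ofReal
  have hzpos : 0 < ∫ g, TwistedSlab.wilsonWeight ρ β g ∂(haarProbability G) := by
    have hint : Integrable (TwistedSlab.wilsonWeight ρ β) (haarProbability G) :=
      hwc.integrable_of_hasCompactSupport (HasCompactSupport.of_compactSpace _)
    rw [integral_pos_iff_support_of_nonneg (fun g => (TwistedSlab.wilsonWeight_pos ρ β g).le) hint]
    have : Function.support (TwistedSlab.wilsonWeight ρ β) = Set.univ :=
      Set.eq_univ_of_forall fun g => (TwistedSlab.wilsonWeight_pos ρ β g).ne'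
    rw [this, measure_univ]; exact one_pos
  have hZ := normaliser_pos (A := A) (G := G) ρ hρ e β
  have hC₀pos : 0 < Real.exp (-(β * (3 * Fintype.card (Plaq A d)))) := Real.exp_pos _
  -- Step A: against the product Haar measure
  have hrefl : ∀ U : Config A d G,
      thetaObs ρ e x₁ l m (configMidReflect e k σ U) = thetaObs ρ e (x₁ - e k) l m U :=
    fun U => thetaObs_congr ρ fun r => hF.configMidReflect_thetaLink hx₁ hl hm U r
  have hA : ∫ U, conj (thetaWitness e k Q h ρ β x₁ l m (configMidReflect e k σ U)) *
        thetaWitness e k Q h ρ β x₁ l m U ∂(gibbs ρ e β) =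
      ((Real.exp (-(β * (3 * Fintype.card (Plaq A d)))) /
          ∫ U, Real.exp (-β * wilsonAction ρ e U) ∂(productHaar A d G) : ℝ) : ℂ) *
        ∫ U, conj (thetaObs ρ e (x₁ - e k) l m U) * thetaObs ρ e x₁ l m U *
          (∏ t ∈ lowerBlock k Q h, (TwistedSlab.wilsonWeight ρ β
            (lowerA e k Q h t U * (U t)⁻¹ * lowerB e k Q h t U) : ℂ)) *
          ((∏ p ∈ Finset.univ.filter (IsUpperPlaq k Q h), Real.exp (β * plaqObs ρ e p U) : ℝ) : ℂ)
          ∂(productHaar A d G) := by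
    rw [integral_gibbs, ← integral_const_mul]
    refine integral_congr_ae (ae_of_all _ fun U => ?_)
    have hw := congrArg (fun r : ℝ => (r : ℂ)) (hF.boltzmann_mul_witnessWeights ρ hρ β U)
    push_cast at hw
    simp only [thetaWitness, map_mul, Complex.conj_ofReal, Complex.real_smul, hrefl U]
    push_cast
    linear_combination (conj (thetaObs ρ e (x₁ - e k) l m U) * thetaObs ρ e x₁ l m U /
      ((∫ U, Real.exp (-β * wilsonAction ρ e U) ∂(productHaar A d G) : ℝ) : ℂ)) * hw
  -- Step B: the upper slab is an independent positive factor
  have hθdep : ∀ (x : A) (U V : Config A d G), ((h x).val = 0 ∨ (h x).val = 1) →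
      (∀ t ∈ ((Finset.univ.filter fun t : Link A d => (h t.1).val = 0 ∨ (h t.1).val = 1 :
        Finset (Link A d)) : Set (Link A d)), U t = V t) →
      thetaObs ρ e x l m U = thetaObs ρ e x l m V := by
    intro x U V hx hUV
    refine thetaObs_congr ρ fun r => hUV _ ?_
    rw [Finset.coe_filter]
    exact ⟨Finset.mem_univ _, by rw [hF.height_thetaLink x hl hm r]; exact hx⟩
  have hfc : Continuous fun U : Config A d G => conj (thetaObs ρ e (x₁ - e k) l m U) *
      thetaObs ρ e x₁ l m U * ∏ t ∈ lowerBlock k Q h, (TwistedSlab.wilsonWeight ρ β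
        (lowerA e k Q h t U * (U t)⁻¹ * lowerB e k Q h t U) : ℂ) :=
    ((continuous_conj.comp (continuous_thetaObs ρ hρ e _ l m)).mul
      (continuous_thetaObs ρ hρ e x₁ l m)).mul (continuous_lowerProd (k := k) (Q := Q) (h := h) ρ hρ β)
  have hupc : Continuous fun U : Config A d G =>
      ∏ p ∈ Finset.univ.filter (IsUpperPlaq k Q h), Real.exp (β * plaqObs ρ e p U) :=
    continuous_exp_upper (k := k) (Q := Q) (h := h) ρ hρ β
  have hB : ∫ U, conj (thetaObs ρ e (x₁ - e k) l m U) * thetaObs ρ e x₁ l m U *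
          (∏ t ∈ lowerBlock k Q h, (TwistedSlab.wilsonWeight ρ β
            (lowerA e k Q h t U * (U t)⁻¹ * lowerB e k Q h t U) : ℂ)) *
          ((∏ p ∈ Finset.univ.filter (IsUpperPlaq k Q h), Real.exp (β * plaqObs ρ e p U) : ℝ) : ℂ)
          ∂(productHaar A d G) =
      (∫ U, conj (thetaObs ρ e (x₁ - e k) l m U) * thetaObs ρ e x₁ l m U *
          ∏ t ∈ lowerBlock k Q h, (TwistedSlab.wilsonWeight ρ β
            (lowerA e k Q h t U * (U t)⁻¹ * lowerB e k Q h t U) : ℂ) ∂(productHaar A d G)) *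
        ∫ U, ((∏ p ∈ Finset.univ.filter (IsUpperPlaq k Q h), Real.exp (β * plaqObs ρ e p U) : ℝ) : ℂ)
          ∂(productHaar A d G) := by
    unfold productHaar
    refine integral_mul_eq_of_dependsOn (haarProbability G)
      (Finset.univ.filter fun t : Link A d => (h t.1).val = 0 ∨ (h t.1).val = 1)
      (Finset.univ.filter fun t : Link A d => ¬ ((h t.1).val = 0 ∨ (h t.1).val = 1))
      (Finset.disjoint_filter.2 fun t _ ht hnt => hnt ht) hfc.measurable
      (continuous_ofReal.comp hupc).measurable (fun U V hUV => ?_) (fun U V hUV => ?_)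
    · rw [hθdep _ U V (Or.inl hx₀0) hUV, hθdep x₁ U V (Or.inr hx₁) hUV]
      congr 1
      refine Finset.prod_congr rfl fun t ht => ?_
      have h0 : (h (t.1 - e k)).val = 0 := hF.val_height_base_of_mem ht
      have h0' : (h (t.1 - e k + e t.2)).val = 0 := by
        rw [hF.height_add_other _ (mem_lowerBlock.1 ht).2, h0]
      have hmem : ∀ s : Link A d, (h s.1).val = 0 ∨ (h s.1).val = 1 →
          s ∈ ((Finset.univ.filter fun t : Link A d => (h t.1).val = 0 ∨ (h t.1).val = 1 :
            Finset (Link A d)) : Set (Link A d)) :=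
        fun s hs => by rw [Finset.coe_filter]; exact ⟨Finset.mem_univ _, hs⟩
      have hblk : IsLowerBlockLink k Q h t := mem_lowerBlock.1 ht
      simp only [lowerA, lowerB, if_pos hblk]
      rw [hUV t (hmem t (Or.inr hblk.1)), hUV _ (hmem (t.1 - e k, t.2) (Or.inl h0)),
        hUV _ (hmem (t.1 - e k + e t.2, k) (Or.inl h0')), hUV _ (hmem (t.1 - e k, k) (Or.inl h0))]
    · refine congrArg (fun r : ℝ => (r : ℂ)) (hF.dependsOn_exp_upper ρ hρ β (fun t ht => hUV t ?_))
      rw [Finset.coe_filter]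
      exact ⟨Finset.mem_univ _, fun h' => h'.elim ht.1 ht.2⟩
  have hup_int : ∫ U, ((∏ p ∈ Finset.univ.filter (IsUpperPlaq k Q h),
        Real.exp (β * plaqObs ρ e p U) : ℝ) : ℂ) ∂(productHaar A d G) =
      ((∫ U, ∏ p ∈ Finset.univ.filter (IsUpperPlaq k Q h), Real.exp (β * plaqObs ρ e p U)
        ∂(productHaar A d G) : ℝ) : ℂ) := integral_complex_ofReal
  have hup_pos : 0 < ∫ U, ∏ p ∈ Finset.univ.filter (IsUpperPlaq k Q h),
      Real.exp (β * plaqObs ρ e p U) ∂(productHaar A d G) := by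
    have hint := TwistedSlab.integrable_config_of_continuous hupc
    rw [integral_pos_iff_support_of_nonneg
      (fun U => (exp_upper_pos (k := k) (Q := Q) (h := h) ρ β U).le) hint]
    have : (Function.support fun U : Config A d G =>
        ∏ p ∈ Finset.univ.filter (IsUpperPlaq k Q h), Real.exp (β * plaqObs ρ e p U)) = Set.univ :=
      Set.eq_univ_of_forall fun U => (exp_upper_pos (k := k) (Q := Q) (h := h) ρ β U).ne'
    rw [this, measure_univ]; exact one_pos
  -- Step C: transfer the theta observable of the layer `1` down through the lower slab
  have hθ₀dep : DependsOn (fun U : Config A d G => conj (thetaObs ρ e (x₁ - e k) l m U))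
      (((lowerBlock k Q h)ᶜ : Finset (Link A d)) : Set (Link A d)) := by
    intro U V hUV
    dsimp only
    rw [thetaObs_congr ρ (x' := x₁ - e k) (V' := V) fun r => hUV _ ?_]
    rw [Finset.coe_compl, Set.mem_compl_iff, Finset.mem_coe]
    intro hmem
    have h1 := (mem_lowerBlock.1 hmem).1
    rw [hF.height_thetaLink _ hl hm r, hx₀0] at h1
    exact absurd h1 (by omega)
  have hC₁ : ∫ U, conj (thetaObs ρ e (x₁ - e k) l m U) * thetaObs ρ e x₁ l m U *
        ∏ t ∈ lowerBlock k Q h, (TwistedSlab.wilsonWeight ρ β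
          (lowerA e k Q h t U * (U t)⁻¹ * lowerB e k Q h t U) : ℂ) ∂(productHaar A d G) =
      (∫ g, (TwistedSlab.wilsonWeight ρ β g : ℂ) ∂(haarProbability G)) ^ ((lowerBlock k Q h).card - 7) *
        (c : ℂ) ^ 7 * ∫ U, conj (thetaObs ρ e (x₁ - e k) l m U) *
          thetaObs ρ e x₁ l m (fun t => lowerB e k Q h t U * lowerA e k Q h t U) ∂(productHaar A d G) :=
    theta_slab_integral_frozen ρ hwc hwinv hc hρ e x₁ l m (lowerBlock k Q h) (lowerA e k Q h)
      (lowerB e k Q h) (fun t => continuous_lowerA t) (fun t => continuous_lowerB t)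
      (fun t => hF.dependsOn_lowerA t) (fun t => dependsOn_lowerB t) _
      (continuous_conj.comp (continuous_thetaObs ρ hρ e _ l m)) hθ₀dep hinj
      (fun r => hF.thetaLink_mem_lowerBlock hx₁ hl hm r)
  have hC₂ : ∀ U : Config A d G,
      thetaObs ρ e x₁ l m (fun t => lowerB e k Q h t U * lowerA e k Q h t U) =
        thetaObs ρ e (x₁ - e k) l m U := by
    intro U
    rw [thetaObs_congr ρ (x' := x₁ - e k) (V' := gaugeAct e (fun z => (U (z, k))⁻¹) U)
      (fun r => hF.lowerB_mul_lowerA_thetaLink hx₁ hl hm U r)]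
    exact thetaObs_gaugeAct ρ e _ (fun z => hdet _) _ l m U
  simp_rw [hC₂] at hC₁
  -- Step D: signs
  have hsq := integral_conj_thetaObs_mul_self ρ e (x₁ - e k) l m (A := A) (G := G)
  have hsq_pos := integral_normSq_thetaObs_pos ρ hρ e (x₁ - e k) l m (A := A) (G := G)
  rw [hA, hB, hC₁, hzr, hup_int, hsq]
  have hc7 : c ^ 7 < 0 := Odd.pow_neg (by decide) hcneg
  have hfin : Real.exp (-(β * (3 * Fintype.card (Plaq A d)))) /
      (∫ U, Real.exp (-β * wilsonAction ρ e U) ∂(productHaar A d G)) *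
      ((∫ g, TwistedSlab.wilsonWeight ρ β g ∂(haarProbability G)) ^ ((lowerBlock k Q h).card - 7) * c ^ 7 *
        (∫ U, ‖thetaObs ρ e (x₁ - e k) l m U‖ ^ 2 ∂(productHaar A d G)) *
        ∫ U, ∏ p ∈ Finset.univ.filter (IsUpperPlaq k Q h), Real.exp (β * plaqObs ρ e p U)
          ∂(productHaar A d G)) < 0 :=
    mul_neg_of_pos_of_neg (div_pos hC₀pos hZ) (mul_neg_of_neg_of_pos
      (mul_neg_of_neg_of_pos (mul_neg_of_pos_of_neg (pow_pos hzpos _) hc7) hsq_pos) hup_pos)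
  have hcast := Complex.real_lt_real.2 hfin
  push_cast at hcast
  simpa using hcast

/-- **Corollary: closed-half LINK reflection positivity, in the shape of
`IsSiteFrame.linkRP_integral_conj_mul_nonneg`, is FALSE at every `β < 0`** for a continuous
three-dimensional representation with `det ρ ≡ 1`, scalar commutant and `ρ ≢ 1` of a compact second
countable group, on any periodic lattice with a site frame carrying a theta graph of height `1` with
seven distinct links. -/
theorem not_linkRP_of_neg (hρ : Continuous ρ) (hirr : TwistedSlab.HasScalarCommutant ρ)
    (hρ1 : ∃ g, ρ g ≠ 1) (hdet : ∀ g, (ρ g).det = 1) {x₁ : A} (hx₁ : (h x₁).val = 1) {l m : Fin d}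
    (hl : l ≠ k) (hm : m ≠ k) (hinj : Function.Injective (thetaLink e x₁ l m)) {β : ℝ} (hβ : β < 0) :
    ¬ ∀ F : Config A d G → ℂ, Measurable F → (∃ C : ℝ, ∀ U, ‖F U‖ ≤ C) →
        IsMidObservable e Q h F →
        0 ≤ ∫ U, conj (F (configMidReflect e k σ U)) * F U ∂(gibbs ρ e β) := by
  intro hall
  have hneg := hF.linkRP_integral_conj_mul_neg_of_neg ρ hρ hirr hρ1 hdet hx₁ hl hm hinj hβ
  have hpos := hall (thetaWitness e k Q h ρ β x₁ l m)
    (continuous_thetaWitness e k Q h ρ hρ β x₁ l m).measurable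
    (exists_norm_thetaWitness_le e k Q h ρ hρ β x₁ l m) (hF.isMidObservable_thetaWitness ρ hx₁ hl hm β)
  exact absurd hpos (not_le_of_gt hneg)

end IsSiteFrame

end TiltedRP

end Summit.QuantumFields.GaugeBoot

end
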